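import Summits.Ventures.CertifiedArithmetic.Expansions.CompressKinkFamilyGeneric
import Mathlib.Tactic.Linarith
import Mathlib.Tactic.Positivity
import Mathlib.Tactic.Ring
import Mathlib.Tactic.NormNum

/-!
# COMPRESS can need any number of passes — at every precision `p ≥ 3` (new work)

New work of the certified-arithmetic venture (ENGINES group: shared numerical engines serving
client cells; rigour lives in the verifiers; every published number belongs to a client cell's
ledger, not to the engines group).  NOT a published theorem: Shewchuk [Shewchuk1997, §2.7] proves
Theorem 23 about ONE pass of COMPRESS and says nothing about iterating it.
`CompressPassesUnbounded.lean` counts the passes of the `p = 3` kink family; this file does the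
same at EVERY precision `p = q + 3 ≥ 3` with the generic family `famG q k` of
`CompressKinkFamilyGeneric.lean` (IEEE ties-to-even `roundTiesEven (q+3) emin`, `emin ≤ 0`):

* `famG_passes`, `famG_pass_changes`: on `famG q k` (a nonoverlapping expansion of `2k + 4`
  `p`-bit floats) COMPRESS changes its input in EACH of the first `k + 1` passes and is fixed
  afterwards;
* `isExpansion_famG`, `isFloat_of_mem_famG`, `length_famG`: the inputs are legitimate;
* `compress_passes_unboundedG` and `compress_passes_unbounded_all_prec`: the summary — for every
  precision `p ≥ 3` and every `k` there is a nonoverlapping expansion of `2k + 4` `p`-bit floats on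
  which COMPRESS needs exactly `k + 1` passes to reach its fixed point, so **at no precision
  `p ≥ 3` does a bound on the number of COMPRESS passes hold uniformly in the length of the
  expansion** (`p = 2`: three passes are known, `CompressThreePasses.lean`; the generic family
  needs `p ≥ 3` for the tie of its window).
-/

namespace Summit.Ventures.CertifiedArithmetic.Expansions

open Literature.ComputerArithmetic.JeannerodRump2018
open Literature.ComputerArithmetic.BoldoJeannerodMelquiondMuller2023 hiding twoSum twoSum_fst
open Literature.ComputerArithmetic.Shewchuk1997

variable {q : ℕ} {emin : ℤ}

/-! ### Counting the passes -/

section passes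
variable (he : emin ≤ 0)
include he

/-- `i` passes move the kink `i` blocks down. [cite: Shewchuk1997, §2.7 p. 332 (COMPRESS)] -/
theorem compress_iterate_stateG : ∀ (i m n : ℕ),
    (compress (roundTiesEven (q + 3) emin))^[i] (stateG q (m + i) n) = stateG q m (n + i)
  | 0, m, n => by simp
  | i + 1, m, n => by
    rw [Function.iterate_succ_apply, show m + (i + 1) = (m + i) + 1 by ring,
      compress_stateG_succ he, compress_iterate_stateG i m (n + 1)]
    ring_nf

/-- **COMPRESS needs exactly `k + 1` passes on `famG q k`**: after `k` passes the kink is at the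
bottom, pass `k + 1` still changes the expansion, and from then on it is fixed.
[cite: Shewchuk1997, §2.7 p. 332 (COMPRESS)] -/
theorem famG_passes (k : ℕ) :
    (compress (roundTiesEven (q + 3) emin))^[k] (famG q k) = stateG q 0 k ∧
      (compress (roundTiesEven (q + 3) emin))^[k + 1] (famG q k) = finalG q k ∧
      (compress (roundTiesEven (q + 3) emin))^[k + 2] (famG q k) = finalG q k ∧
      (compress (roundTiesEven (q + 3) emin))^[k + 1] (famG q k) ≠
        (compress (roundTiesEven (q + 3) emin))^[k] (famG q k) := by
  have hk : (compress (roundTiesEven (q + 3) emin))^[k] (famG q k) = stateG q 0 k := by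
    simpa [famG] using compress_iterate_stateG he k 0 0
  have hk1 : (compress (roundTiesEven (q + 3) emin))^[k + 1] (famG q k) = finalG q k := by
    rw [Function.iterate_succ_apply', hk, compress_stateG_zero he]
  have hk2 : (compress (roundTiesEven (q + 3) emin))^[k + 2] (famG q k) = finalG q k := by
    rw [show k + 2 = (k + 1) + 1 by ring, Function.iterate_succ_apply', hk1, compress_finalG he]
  refine ⟨hk, hk1, hk2, ?_⟩
  rw [hk1, hk]
  -- the two lists differ in their first component: `1` versus `−(h−1)`
  have h1 : (1 : ℚ) ≤ 2 ^ q := (yfactsG q).1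
  have e1 : (finalG q k).head? = some 1 := by simp [finalG]
  have e2 : (stateG q 0 k).head? = some (-(4 * 2 ^ q - 1) * 2 ^ 0) := by
    simp only [stateG, pairsG, kinkG, scG_cons, Nat.mul_zero, List.nil_append, List.cons_append,
      List.head?_cons]
  intro h
  rw [h, e2, pow_zero, mul_one, Option.some.injEq] at e1
  linarith

/-- Hence EVERY one of the first `k + 1` passes changes the expansion (a pass that changed nothing
would freeze all later ones). [cite: Shewchuk1997, §2.7 p. 332 (COMPRESS)] -/
theorem famG_pass_changes (k j : ℕ) (hj : j ≤ k) :
    (compress (roundTiesEven (q + 3) emin))^[j + 1] (famG q k) ≠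
      (compress (roundTiesEven (q + 3) emin))^[j] (famG q k) := by
  intro h
  rw [Function.iterate_succ_apply'] at h
  have frozen : ∀ t : ℕ, (compress (roundTiesEven (q + 3) emin))^[j + t] (famG q k) =
      (compress (roundTiesEven (q + 3) emin))^[j] (famG q k) := by
    intro t
    induction t with
    | zero => rfl
    | succ t ih => rw [← add_assoc, Function.iterate_succ_apply', ih, h]
  obtain ⟨-, -, -, hne⟩ := famG_passes (q := q) he k
  apply hne
  obtain ⟨d, rfl⟩ := Nat.exists_eq_add_of_le hj
  rw [show j + d + 1 = j + (d + 1) by ring, frozen (d + 1), frozen d]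

end passes

/-! ### `famG q k` is a nonoverlapping expansion of `p`-bit floats -/

/-- The pair coefficients lie below the block ratio: `h + 1 < 2^(3p)` and
`(h−1)·2^(2p−1) < 2^(3p)`. [cite: Shewchuk1997, §2.1 (nonoverlapping)] -/
theorem famG_abs_lt_block (q : ℕ) : |((4 * 2 ^ q + 1) : ℚ)| < 2 ^ (3 * q + 9) ∧
    |(-(4 * 2 ^ q - 1) * (32 * (2 ^ q) ^ 2) : ℚ)| < 2 ^ (3 * q + 9) := by
  obtain ⟨h1, h2, h3, -⟩ := yfactsG q
  rw [two_pow_blockG, abs_of_pos (by positivity),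
    abs_of_neg (mul_neg_of_neg_of_pos (by linarith) (by positivity))]
  constructor <;> nlinarith

/-- Every component of `m` pair blocks lies below `2^(3pm)`. [cite: Shewchuk1997, §2.1] -/
theorem abs_lt_of_mem_pairsG (q : ℕ) :
    ∀ (m : ℕ) (x : ℚ), x ∈ pairsG q m → |x| < (2 : ℚ) ^ ((3 * q + 9) * m)
  | 0, x, hx => by simp [pairsG] at hx
  | m + 1, x, hx => by
    obtain ⟨ha, hb⟩ := famG_abs_lt_block q
    have hpow : (2 : ℚ) ^ ((3 * q + 9) * m) * 2 ^ (3 * q + 9) = 2 ^ ((3 * q + 9) * (m + 1)) := by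
      rw [← pow_add, show (3 * q + 9) * m + (3 * q + 9) = (3 * q + 9) * (m + 1) by ring]
    have hP : (0 : ℚ) < 2 ^ ((3 * q + 9) * m) := by positivity
    rw [pairsG, List.mem_append] at hx
    rw [← hpow]
    rcases hx with hx | hx
    · exact (abs_lt_of_mem_pairsG q m x hx).trans_le
        (le_mul_of_one_le_right hP.le (one_le_pow₀ (by norm_num)))
    · simp only [scG_cons, scG_nil, List.mem_cons, List.not_mem_nil, or_false] at hx
      rcases hx with rfl | rfl
      · rw [abs_mul, abs_of_pos hP, mul_comm]; exact mul_lt_mul_of_pos_left ha hP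
      · rw [abs_mul, abs_of_pos hP, mul_comm]; exact mul_lt_mul_of_pos_left hb hP

/-- The pair blocks form a nonoverlapping expansion. [cite: Shewchuk1997, §2.1 (nonoverlapping)] -/
theorem isExpansion_pairsG (q : ℕ) : ∀ m : ℕ, IsExpansion 1 (pairsG q m)
  | 0 => isExpansion_nil 1
  | m + 1 => by
    obtain ⟨h1, h2, -⟩ := yfactsG q
    have hP : (0 : ℚ) < 2 ^ ((3 * q + 9) * m) := by positivity
    have h2q5 : (2 : ℚ) ^ (2 * q + 5) = 32 * (2 ^ q) ^ 2 := by rw [pow_add, pow_mul']; ring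
    rw [pairsG, IsExpansion, List.pairwise_append]
    refine ⟨isExpansion_pairsG q m, ?_, ?_⟩
    · simp only [scG_cons, scG_nil]
      refine List.Pairwise.cons ?_ (List.pairwise_singleton _ _)
      intro y hy
      simp only [List.mem_cons, List.not_mem_nil, or_false] at hy
      subst hy
      -- `−(h−1)·2^(2p−1)·2^(3pm)` lies on the grid `2^(3pm + 2p − 1)`, above `|h+1|·2^(3pm)`
      refine ⟨(((3 * q + 9) * m : ℕ) : ℤ) + ((2 * q + 5 : ℕ) : ℤ), ⟨-(4 * 2 ^ q - 1), ?_⟩, ?_⟩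
      · rw [zpow_add₀ (by norm_num : (2 : ℚ) ≠ 0), zpow_natCast, zpow_natCast, h2q5]
        push_cast; ring
      · rw [one_mul, abs_mul, abs_of_pos hP, abs_of_pos (by positivity : (0 : ℚ) < 4 * 2 ^ q + 1),
          zpow_add₀ (by norm_num : (2 : ℚ) ≠ 0), zpow_natCast, zpow_natCast, h2q5]
        calc ((4 * 2 ^ q + 1) : ℚ) * 2 ^ ((3 * q + 9) * m)
            < 32 * (2 ^ q) ^ 2 * 2 ^ ((3 * q + 9) * m) := mul_lt_mul_of_pos_right (by nlinarith) hP
          _ = _ := mul_comm _ _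
    · intro x hx y hy
      have hxm := abs_lt_of_mem_pairsG q m x hx
      simp only [scG_cons, scG_nil, List.mem_cons, List.not_mem_nil, or_false] at hy
      rcases hy with rfl | rfl
      · exact ⟨(((3 * q + 9) * m : ℕ) : ℤ), ⟨4 * 2 ^ q + 1, by rw [zpow_natCast]; push_cast; ring⟩,
          by rwa [one_mul, zpow_natCast]⟩
      · exact ⟨(((3 * q + 9) * m : ℕ) : ℤ), ⟨-(4 * 2 ^ q - 1) * (32 * (2 ^ q) ^ 2),
          by rw [zpow_natCast]; push_cast; ring⟩, by rwa [one_mul, zpow_natCast]⟩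

/-- **`famG q k` is a nonoverlapping expansion** (each component on a grid strictly above the
lower ones). [cite: Shewchuk1997, §2.1 (nonoverlapping)] -/
theorem isExpansion_famG (q k : ℕ) : IsExpansion 1 (famG q k) := by
  obtain ⟨h1, h2, h3, h4, -⟩ := yfactsG q
  have hP : (0 : ℚ) < 2 ^ ((3 * q + 9) * k) := by positivity
  have hp3 : (2 : ℚ) ^ (q + 3) = 8 * 2 ^ q := by rw [pow_add]; ring
  have h2q6 : (2 : ℚ) ^ (2 * q + 6) = 64 * (2 ^ q) ^ 2 := by rw [pow_add, pow_mul']; ring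
  have h4q12 : (2 : ℚ) ^ (4 * q + 12) = 4096 * (2 ^ q) ^ 4 := by rw [pow_add, pow_mul']; ring
  have hm1neg : (-(4 * 2 ^ q - 1) * (8 * 2 ^ q) : ℚ) < 0 :=
    mul_neg_of_neg_of_pos (by linarith) (by positivity)
  have hfam : famG q k = pairsG q k ++ scG ((3 * q + 9) * k)
      [-(4 * 2 ^ q - 1), -(4 * 2 ^ q - 1) * (8 * 2 ^ q), (6 * 2 ^ q + 1) * (64 * (2 ^ q) ^ 2),
        -(4 * 2 ^ q + 1) * (4096 * (2 ^ q) ^ 4)] := by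
    simp [famG, stateG, kinkG, debrisG]
  -- gaps inside the tail `⟨−(h−1), −(h−1)·2^p, (3h/2+1)·2^(2p), −(h+1)·2^(4p)⟩·2^(3pk)`
  have gap : ∀ (a b : ℚ) (j : ℕ) (r : ℤ), b = r * 2 ^ j → |a| < 2 ^ j →
      Below 1 (a * 2 ^ ((3 * q + 9) * k)) (b * 2 ^ ((3 * q + 9) * k)) := by
    intro a b j r hb ha
    refine ⟨(((3 * q + 9) * k : ℕ) : ℤ) + (j : ℤ), ⟨r, ?_⟩, ?_⟩
    · rw [zpow_add₀ (by norm_num : (2 : ℚ) ≠ 0), zpow_natCast, zpow_natCast, hb]; ring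
    · rw [one_mul, abs_mul, abs_of_pos hP, zpow_add₀ (by norm_num : (2 : ℚ) ≠ 0), zpow_natCast,
        zpow_natCast]
      calc |a| * 2 ^ ((3 * q + 9) * k) < 2 ^ j * 2 ^ ((3 * q + 9) * k) :=
            mul_lt_mul_of_pos_right ha hP
        _ = _ := mul_comm _ _
  rw [hfam, IsExpansion, List.pairwise_append]
  refine ⟨isExpansion_pairsG q k, ?_, ?_⟩
  · simp only [scG_cons, scG_nil]
    refine List.Pairwise.cons ?_ (List.Pairwise.cons ?_ (List.Pairwise.cons ?_
      (List.pairwise_singleton _ _)))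
    · intro y hy
      simp only [List.mem_cons, List.not_mem_nil, or_false] at hy
      rcases hy with rfl | rfl | rfl
      · exact gap _ _ (q + 3) (-(4 * 2 ^ q - 1)) (by push_cast; rw [pow_add]; ring)
          (by rw [abs_of_neg (by linarith), hp3]; linarith)
      · exact gap _ _ (2 * q + 6) (6 * 2 ^ q + 1) (by push_cast; rw [pow_add, pow_mul']; ring)
          (by rw [abs_of_neg (by linarith), h2q6]; nlinarith)
      · exact gap _ _ (4 * q + 12) (-(4 * 2 ^ q + 1)) (by push_cast; rw [pow_add, pow_mul']; ring)
          (by rw [abs_of_neg (by linarith), h4q12]; nlinarith)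
    · intro y hy
      simp only [List.mem_cons, List.not_mem_nil, or_false] at hy
      rcases hy with rfl | rfl
      · exact gap _ _ (2 * q + 6) (6 * 2 ^ q + 1) (by push_cast; rw [pow_add, pow_mul']; ring)
          (by rw [abs_of_neg hm1neg, h2q6]; nlinarith)
      · exact gap _ _ (4 * q + 12) (-(4 * 2 ^ q + 1)) (by push_cast; rw [pow_add, pow_mul']; ring)
          (by rw [abs_of_neg hm1neg, h4q12]; nlinarith)
    · intro y hy
      simp only [List.mem_cons, List.not_mem_nil, or_false] at hy
      subst hy
      exact gap _ _ (4 * q + 12) (-(4 * 2 ^ q + 1)) (by push_cast; rw [pow_add, pow_mul']; ring)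
        (by rw [abs_of_pos (by positivity), h4q12]; nlinarith)
  · intro x hx y hy
    have hxk := abs_lt_of_mem_pairsG q k x hx
    simp only [scG_cons, scG_nil, List.mem_cons, List.not_mem_nil, or_false] at hy
    rcases hy with rfl | rfl | rfl | rfl
    · exact ⟨(((3 * q + 9) * k : ℕ) : ℤ), ⟨-(4 * 2 ^ q - 1), by rw [zpow_natCast]; push_cast; ring⟩,
        by rwa [one_mul, zpow_natCast]⟩
    · exact ⟨(((3 * q + 9) * k : ℕ) : ℤ), ⟨-(4 * 2 ^ q - 1) * (8 * 2 ^ q),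
        by rw [zpow_natCast]; push_cast; ring⟩, by rwa [one_mul, zpow_natCast]⟩
    · exact ⟨(((3 * q + 9) * k : ℕ) : ℤ), ⟨(6 * 2 ^ q + 1) * (64 * (2 ^ q) ^ 2),
        by rw [zpow_natCast]; push_cast; ring⟩, by rwa [one_mul, zpow_natCast]⟩
    · exact ⟨(((3 * q + 9) * k : ℕ) : ℤ), ⟨-(4 * 2 ^ q + 1) * (4096 * (2 ^ q) ^ 4),
        by rw [zpow_natCast]; push_cast; ring⟩, by rwa [one_mul, zpow_natCast]⟩

/-- **The components of `famG q k` are `p`-bit floats** (`emin ≤ 0`). [cite: JeannerodRump2018, §1] -/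
theorem isFloat_of_mem_famG (he : emin ≤ 0) (q k : ℕ) :
    ∀ x ∈ famG q k, IsFloat (q + 3) emin x := by
  obtain ⟨ha, hb, hm0, hm1, hm2, -, -, hS, -⟩ := famG_isFloat (q := q) he
  have hpairs : ∀ (m : ℕ) (x : ℚ), x ∈ pairsG q m → IsFloat (q + 3) emin x := by
    intro m
    induction m with
    | zero => intro x hx; simp [pairsG] at hx
    | succ m ih =>
      intro x hx
      rw [pairsG, List.mem_append] at hx
      rcases hx with hx | hx
      · exact ih x hx
      · simp only [scG_cons, scG_nil, List.mem_cons, List.not_mem_nil, or_false] at hx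
        rcases hx with rfl | rfl
        · exact isFloatG_sc _ ha
        · exact isFloatG_sc _ hb
  have hfam : famG q k = pairsG q k ++ scG ((3 * q + 9) * k)
      [-(4 * 2 ^ q - 1), -(4 * 2 ^ q - 1) * (8 * 2 ^ q), (6 * 2 ^ q + 1) * (64 * (2 ^ q) ^ 2),
        -(4 * 2 ^ q + 1) * (4096 * (2 ^ q) ^ 4)] := by
    simp [famG, stateG, kinkG, debrisG]
  rw [hfam]
  intro x hx
  rw [List.mem_append] at hx
  rcases hx with hx | hx
  · exact hpairs k x hx
  · simp only [scG_cons, scG_nil, List.mem_cons, List.not_mem_nil, or_false] at hx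
    rcases hx with rfl | rfl | rfl | rfl
    · exact isFloatG_sc _ hm0
    · exact isFloatG_sc _ hm1
    · exact isFloatG_sc _ hm2
    · exact isFloatG_sc _ hS

/-- **COMPRESS PASS COUNTS ARE UNBOUNDED AT PRECISION `q + 3`** (summary): for every `k`,
`famG q k` is a nonoverlapping expansion of `2k + 4` `(q+3)`-bit floats on which COMPRESS
(ties-to-even, `emin ≤ 0`) changes its input in each of the first `k + 1` passes and is fixed
afterwards. [cite: Shewchuk1997, §2.7 p. 332 (COMPRESS)] -/
theorem compress_passes_unboundedG (he : emin ≤ 0) (q k : ℕ) :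
    (famG q k).length = 2 * k + 4 ∧ IsExpansion 1 (famG q k) ∧
      (∀ x ∈ famG q k, IsFloat (q + 3) emin x) ∧
      (∀ j ≤ k, (compress (roundTiesEven (q + 3) emin))^[j + 1] (famG q k) ≠
        (compress (roundTiesEven (q + 3) emin))^[j] (famG q k)) ∧
      (compress (roundTiesEven (q + 3) emin))^[k + 2] (famG q k) =
        (compress (roundTiesEven (q + 3) emin))^[k + 1] (famG q k) :=
  ⟨length_famG q k, isExpansion_famG q k, isFloat_of_mem_famG he q k,
    fun j hj => famG_pass_changes he k j hj,
    by rw [(famG_passes (q := q) he k).2.2.1, (famG_passes (q := q) he k).2.1]⟩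

/-- **AT EVERY PRECISION `p ≥ 3`**: for every `k` there is a nonoverlapping expansion of `2k + 4`
`p`-bit floats on which COMPRESS (`roundTiesEven p emin`, `emin ≤ 0`) changes its input in each of
the first `k + 1` passes and is fixed from pass `k + 2` on — no bound on the number of passes
needed to reach the fixed point holds uniformly in the length of the expansion, at any precision.
[cite: Shewchuk1997, §2.7 p. 332 (COMPRESS)] -/
theorem compress_passes_unbounded_all_prec (he : emin ≤ 0) {p : ℕ} (hp : 3 ≤ p) (k : ℕ) :
    ∃ e : List ℚ, e.length = 2 * k + 4 ∧ IsExpansion 1 e ∧ (∀ x ∈ e, IsFloat p emin x) ∧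
      (∀ j ≤ k, (compress (roundTiesEven p emin))^[j + 1] e ≠
        (compress (roundTiesEven p emin))^[j] e) ∧
      (compress (roundTiesEven p emin))^[k + 2] e = (compress (roundTiesEven p emin))^[k + 1] e := by
  obtain ⟨q, rfl⟩ : ∃ q, p = q + 3 := ⟨p - 3, by omega⟩
  exact ⟨famG q k, compress_passes_unboundedG he q k⟩

end Summit.Ventures.CertifiedArithmetic.Expansions
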